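import Summits.HodgeConjecture.HodgeConjecture.Theses.EndoscopicMiddleDegree
import Literature.AlgebraicGeometry.ShimuraVarieties.SpecialCycleClasses

/-!
# `MiddleThetaSpan` (stmt-HodgeConjecture-13661) · Negative · the support-widening `C′`

Negative knowledge for the crux `EndoscopicMiddleDegree.MiddleThetaSpan` (route
EndoscopicMiddleDegree, rank 2): its second summand `span{s ∪ d : s ∈ SC^m(D), d ∈ N¹H²}` (products of
codimension-`m` special cycle classes with divisor classes, at the FIXED level `D`) is contained in the
support-widening `SCsupp^m := ⨆_{dim W = m} (classes of degree 2(m+1) supported on c(W))`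
(`mem_scSupported_of_mem_spanCup`), and hence the crux implies its widened form `C′` (summand 2 ↦
`SCsupp^m`; `mem_widened_of_middleThetaSpan`). `C′` — not the crux — is the shape that
Bergeron–Millson–Moeglin's tower-level mechanism (arXiv:1306.1515 Thm 71, product Schwartz functions,
p. 40) delivers at a fixed level: the trace `e_K([Z'] ∪ h')` of a product at a deeper level is
supported on the image of the special cycle `Z'` but is not a product at level `K` (refuter risk R1 /
CAVEAT-13661). A fixed-level counterexample to the crux lying in `SCsupp` would therefore classify the
crux `refuted-misstated` with repair `C′` (or the sharper `C″` of the disprover's work file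
`Cruxes/MiddleThetaSpan/Disproof.lean`, F3). `specialCycleClasses D k` is by `rfl` the route file's
inlined `⨆`-rendering (`iSup_eq_specialCycleClasses`). Refuter seat
refuter-cdisprove-stmt-HodgeConjecture-13661-g2-0 (cdisprove cycle 2), 2026-08-16; mathematics of
cycle 1 (refuter-cdisprove-stmt-HodgeConjecture-13661-0).
-/

noncomputable section

-- The mandated namespace `Summit.<P>.<Sub>.Theorems.…` repeats `HodgeConjecture` (single-conjunct summit).
set_option linter.dupNamespace false

namespace Summit.HodgeConjecture.HodgeConjecture.Theorems.MiddleThetaSpan.Negative.SupportWidening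

open Literature.AlgebraicGeometry Literature.AlgebraicGeometry.HodgeTheory
  Literature.AlgebraicGeometry.ShimuraVarieties Literature.AlgebraicTopology.SingularHomology
open Summit.HodgeConjecture.HodgeConjecture.Theses.EndoscopicMiddleDegree (MiddleThetaSpan)

variable {p : ℕ} {X : Motives.SchemeOver ℂ}

/-- The inlined special-cycle span of the route file is `specialCycleClasses` (the cone-repair rendering
is `rfl`). [cite: BergeronMillsonMoeglin2016Balls, Introduction §1.7] -/
theorem iSup_eq_specialCycleClasses (D : UnitaryBallQuotientDatum p X) (k : ℕ) :
    (⨆ (W : Submodule D.E (Fin (p + 1) → D.E)) (_ : IsTotallyPositive (conjRingHom D.E) D.H W)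
      (_ : Module.finrank D.E W = k), classesSupportedOn X (D.specialSubvariety W) (2 * k)) =
      specialCycleClasses D k := rfl

/-- A class supported on a Zariski-closed `Z`, cupped with ANY class, stays supported on `Z`
(`H_Z ∪ H ⊆ H_{Z ∩ X} = H_Z`). [cite: Fulton1998, §19.2 Cor. 19.2] -/
theorem cup_mem_classesSupportedOn_left {Z : Set X.left} (hZ : IsClosed Z) {i j n : ℕ}
    (h : i + j = n) {s : complexBetti X i} (hs : s ∈ classesSupportedOn X Z i)
    (d : complexBetti X j) : cupProduct h s d ∈ classesSupportedOn X Z n := by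
  have hd : d ∈ classesSupportedOn X Set.univ j := by
    rw [classesSupportedOn_univ]; exact Submodule.mem_top
  simpa only [Set.inter_univ] using cupProduct_mem_classesSupportedOn_inter hZ isClosed_univ h hs hd

/-- A special cycle class of codimension `k`, cupped with any class of degree `j`, is supported on a
codimension-`k` special cycle (in degree `2k + j`). [cite: Fulton1998, §19.2 Cor. 19.2] -/
theorem cup_mem_scSupported_of_mem_specialCycleClasses (D : UnitaryBallQuotientDatum p X) {k j n : ℕ}
    (h : 2 * k + j = n) {s : complexBetti X (2 * k)} (hs : s ∈ specialCycleClasses D k)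
    (d : complexBetti X j) :
    cupProduct h s d ∈ ⨆ (W : Submodule D.E (Fin (p + 1) → D.E))
      (_ : IsTotallyPositive (conjRingHom D.E) D.H W) (_ : Module.finrank D.E W = k),
      classesSupportedOn X (D.specialSubvariety W) n := by
  rw [← iSup_eq_specialCycleClasses] at hs
  induction hs using Submodule.iSup_induction' with
  | mem W s hs =>
    by_cases hW : IsTotallyPositive (conjRingHom D.E) D.H W
    · rw [iSup_pos hW] at hs
      by_cases hk : Module.finrank D.E W = k
      · rw [iSup_pos hk] at hs
        exact Submodule.mem_iSup_of_mem W (Submodule.mem_iSup_of_mem hW (Submodule.mem_iSup_of_mem hk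
          (cup_mem_classesSupportedOn_left (D.isClosed_specialSubvariety W hW) _ hs d)))
      · rw [iSup_neg hk, Submodule.mem_bot] at hs
        rw [hs, map_zero, LinearMap.zero_apply]; exact Submodule.zero_mem _
    · rw [iSup_neg hW, Submodule.mem_bot] at hs
      rw [hs, map_zero, LinearMap.zero_apply]; exact Submodule.zero_mem _
  | zero => rw [map_zero, LinearMap.zero_apply]; exact Submodule.zero_mem _
  | add x y _ _ hx hy => rw [map_add, LinearMap.add_apply]; exact Submodule.add_mem _ hx hy

/-- **Summand 2 ≤ SCsupp.** Every element of the crux's second summand (span of `s ∪ d`, `s` a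
codimension-`m` special cycle class, `d` a divisor class) is supported on a codimension-`m` special
cycle. (The converse inclusion is what fails for the fixed-level output of BMM's Thm 71.)
[cite: BergeronMillsonMoeglin2016Balls, Part 2 Thm 71] -/
theorem mem_scSupported_of_mem_spanCup (m : ℕ) (D : UnitaryBallQuotientDatum (2 * (m + 1)) X)
    {z : complexBetti X (2 * (m + 1))}
    (hz : z ∈ Submodule.span ℂ {z : complexBetti X (2 * (m + 1)) |
      ∃ s ∈ specialCycleClasses D m, ∃ d ∈ algebraicClasses X 1,
        z = cupProduct (two_mul_add_two_mul m 1) s d}) :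
    z ∈ ⨆ (W : Submodule D.E (Fin (2 * (m + 1) + 1) → D.E))
      (_ : IsTotallyPositive (conjRingHom D.E) D.H W) (_ : Module.finrank D.E W = m),
      classesSupportedOn X (D.specialSubvariety W) (2 * (m + 1)) := by
  revert hz
  refine fun hz ↦ (Submodule.span_le.2 ?_) hz
  rintro w ⟨s, hs, d, -, rfl⟩
  exact cup_mem_scSupported_of_mem_specialCycleClasses D _ hs d

/-- **`MiddleThetaSpan ⟹ C′` (support-widened form).** The typed crux implies the statement in which
summand 2 is widened from `SC^m · N¹` to all middle-degree classes supported on codimension-`m` special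
cycles; a counterexample to the crux inside `SCsupp` would make the crux misstated with this repair.
[cite: BergeronMillsonMoeglin2016Balls, Part 2 Thm 71] -/
theorem mem_widened_of_middleThetaSpan (h : MiddleThetaSpan) (m : ℕ) (X : Motives.SchemeOver ℂ)
    (D : UnitaryBallQuotientDatum (2 * (m + 1)) X) (hm1 : 1 ≤ m) (hm2 : m ≤ 2)
    (c : complexBetti X (2 * (m + 1))) (hc : IsRationalClass c)
    (hH : IsOfHodgeType (2 * (m + 1)) X (2 * (m + 1)) (m + 1) (m + 1) c) :
    c ∈ specialCycleClasses D (m + 1) ⊔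
      (⨆ (W : Submodule D.E (Fin (2 * (m + 1) + 1) → D.E))
        (_ : IsTotallyPositive (conjRingHom D.E) D.H W) (_ : Module.finrank D.E W = m),
        classesSupportedOn X (D.specialSubvariety W) (2 * (m + 1))) ⊔
      Submodule.span ℂ {z : complexBetti X (2 * (m + 1)) |
        ∃ a : complexBetti X (2 * m), IsRationalClass a ∧
          IsOfHodgeType (2 * (m + 1)) X (2 * m) m m a ∧
            ∃ d ∈ algebraicClasses X 1, z = cupProduct (two_mul_add_two_mul m 1) a d} := by
  have hc' := h m X D hm1 hm2 c hc hH
  rw [iSup_eq_specialCycleClasses, iSup_eq_specialCycleClasses] at hc'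
  obtain ⟨y, hy, w, hw, rfl⟩ := Submodule.mem_sup.1 hc'
  obtain ⟨u, hu, v, hv, rfl⟩ := Submodule.mem_sup.1 hy
  exact Submodule.add_mem _ (Submodule.add_mem _ (Submodule.mem_sup_left (Submodule.mem_sup_left hu))
    (Submodule.mem_sup_left (Submodule.mem_sup_right (mem_scSupported_of_mem_spanCup m D hv))))
    (Submodule.mem_sup_right hw)

end Summit.HodgeConjecture.HodgeConjecture.Theorems.MiddleThetaSpan.Negative.SupportWidening

end
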